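import Literature.MathematicalPhysics.QuantumFieldTheory.Federbush1986.RadialGaugePrimitive
import Literature.MathematicalPhysics.QuantumFieldTheory.Federbush1986.LatticeAxialPotential
import Literature.MathematicalPhysics.QuantumFieldTheory.Federbush1986.ApproxTopBound

/-!
# `Federbush1986.GaugeFixedCompetitor` — [Federbush1986PhaseCellI] §3 (3.2)/(3.4) p. 327, §4 (4.3)–(4.5) p. 329: THE
# GAUGE-FIXED COMPETITOR `ψ̂_L = ψ − d(K₀ψ + λ_L)` — ALL its level-0 bond variables vanish on the box of size `L`, and its
# `L¹` norm on balls grows polynomially — PROVED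

statement-level skeleton of published theorems with citation tags; proofs where landed; nothing here is a claim about the Yang–Mills mass gap

CITATION HEADER.  P. Federbush, *A phase cell approach to Yang–Mills theory. I*, Commun. Math. Phys. **107** (1986) 319–329
[Federbush1986PhaseCellI]: §3 p. 327 *«minimizing the continuum action subject to this constraint»* with (3.2)
`A = A^N + ∂Λ` and (3.4) (the constraints), §4 p. 329 (4.3)–(4.5) and *«Mirabile dictu the bond assignments to e at level 0,
due to this A_μ(x), are exactly the A(e)»* (bond variables of a pure gauge = lattice gradient), (2.1)–(2.2), (2.5) p. 325 (the
level-0 bond variable as a box integral), (3.13) p. 328.  Stage C of the constrained-minimality programme for the hypothesis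
`hmin` of `CorrectedMode.modeEstimatesLe_of_field_minimal` (unit `lit-balaban-r17` gen 12; SKELETON rows F1.Eq3.1, F1.Eq4.1-4.6).

THE MATHEMATICS.  Let `ψ ∈ C¹` have vanishing level-0 plaquette variables.  (§1) A level-0 bond variable is a tent-weighted
box integral, so `|A(b, μ)| ≤ ∫_{B_ρ}|A_μ|` when the bond box `x_b + [0,1]³×[0,2]` lies in `B_ρ`
(**`abs_approxTop_le_setIntegral`**; `‖x_b + u‖ ≤ 2(B+2)` if `|b_k| ≤ B`).  (§2) The radial representative `ψ̃ = radial ψ`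
(`RadialGaugePrimitive`) has curl-free bond variables `k = bondVar ψ` (`plaqOfBonds_bondVar`); with `g_L` their axial potential
from the corner `(−L,…,−L)` and `λ_L = interp (boxSet L) g_L` the smooth gauge function of `LatticeAxialPotential`,
`ψ̂_L := ψ̃ − dλ_L` (`psiHat`) is continuous and **`approxTop_psiHat_eq_zero`**: `ψ̂_L(b, μ) = 0` for `−L ≤ b_j ≤ L`, `b_μ + 1 ≤ L`
(the lattice Poincaré lemma `axialPot_gradient` + «Mirabile dictu» `approxTop_pureGauge_interp`).  (§3) GROWTH: with
`M = sup_{B_1}|F(ψ)|₁`, `S = ∫|F(ψ)|₁²` (finite: `|F|₁² ≤ 256·actionDensity`, `integrable_norm1_sq`), `∫_{B_r}|ψ̃_ν| ≤ p(r) =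
(M+1)V r⁵ + S r⁴` (`setIntegral_abs_radial_le`), `|k(b, μ)| ≤ p(2(B+2))` for `|b_k| ≤ B` (`abs_bondVar_le`), `|g_L(n)| ≤ 8L·p(2(L+2))`
on the box (`abs_latPotential_le`: `≤ 8L` path bonds, all in the box), `|∂_νλ_L| ≤ B·8L·p(2(L+2))` pointwise (`interp_bound`),
whence **`exists_psiHat_growth`**: `∫_{B_{4R+10}}|ψ̂_{2R+6,ν}| ≤ C(R+10)^{10}` for all `R ∈ ℕ`.

WHAT THIS MODULE PROVIDES.  Defs with bodies `bondVar`, `corner`, `boxSet`, `latPotential`, `gaugeFn`, `psiHat`, `growthPoly`;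
the theorems above.  No `Prop` fact, no `sorry`; axioms standard.
-/

namespace Literature.MathematicalPhysics.QuantumFieldTheory.Federbush1986

open Filter Set MeasureTheory Metric
open scoped Topology BigOperators

noncomputable section

namespace RadialGauge

open ModeLinearity LatticePotential

variable {ψ : E4 → Fin 4 → ℝ}

/-! ## §1 Bond variables as box integrals: `|A(b, μ)| ≤ ∫_{B_ρ} |A_μ|` when the bond box lies in `B_ρ` -/

/-- The affine parametrisation `u ↦ x_b + u` of the bond box, as a measurable equivalence `ℝ⁴ ≃ E4`. [folklore] -/
private def boxMap (b : Fin 4 → ℤ) : (Fin 4 → ℝ) ≃ᵐ E4 :=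
  (MeasurableEquiv.toLp 2 (Fin 4 → ℝ)).trans (MeasurableEquiv.addLeft ((⟨b, (0 : Fin 4)⟩ : Edge 0).src))

/-- The parametrisation is `u ↦ x_b + u`. [folklore] -/
private theorem boxMap_apply (b : Fin 4 → ℤ) (u : Fin 4 → ℝ) :
    boxMap b u = ((⟨b, (0 : Fin 4)⟩ : Edge 0).src) + mkPt u := rfl

/-- The parametrisation preserves Lebesgue measure. [folklore] -/
private theorem measurePreserving_boxMap (b : Fin 4 → ℤ) : MeasurePreserving (boxMap b) volume volume :=
  (measurePreserving_add_left volume _).comp (PiLp.volume_preserving_toLp (Fin 4))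

/-- Coordinates of a point of the bond box. [cite: Federbush1986PhaseCellI, (2.1)–(2.2) p. 325] -/
theorem src_add_mkPt_apply (b : Fin 4 → ℤ) (μ : Fin 4) (u : Fin 4 → ℝ) (k : Fin 4) :
    (((⟨b, μ⟩ : Edge 0).src) + mkPt u : E4) k = (b k : ℝ) + u k := by
  simp [Edge.src, mkPt, latLen_zero]

/-- **Norm bound on the bond box**: if `|b_k| ≤ B` for all `k` then every point `x_b + u`, `u ∈ [0,1]³×[0,2]`, has
`‖x_b + u‖ ≤ 2(B + 2)`. [cite: Federbush1986PhaseCellI, (2.1)–(2.2) p. 325] -/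
theorem norm_src_add_mkPt_le {b : Fin 4 → ℤ} {μ : Fin 4} {B : ℝ} (hb : ∀ k, |(b k : ℝ)| ≤ B) {u : Fin 4 → ℝ}
    (hu : u ∈ Icc (0 : Fin 4 → ℝ) (boxUp μ)) : ‖(((⟨b, μ⟩ : Edge 0).src) + mkPt u : E4)‖ ≤ 2 * (B + 2) := by
  have hB : 0 ≤ B := (abs_nonneg _).trans (hb 0)
  have hcoord : ∀ k, |(((⟨b, μ⟩ : Edge 0).src + mkPt u : E4) k)| ≤ B + 2 := by
    intro k
    rw [src_add_mkPt_apply]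
    have h0 : 0 ≤ u k := hu.1 k
    have h2 : u k ≤ 2 := by
      have := hu.2 k; simp only [boxUp] at this; split_ifs at this <;> linarith
    calc |(b k : ℝ) + u k| ≤ |(b k : ℝ)| + |u k| := abs_add_le _ _
      _ ≤ B + 2 := add_le_add (hb k) (by rw [abs_of_nonneg h0]; exact h2)
  rw [EuclideanSpace.norm_eq]
  have h4 : ∑ k : Fin 4, (((⟨b, μ⟩ : Edge 0).src + mkPt u : E4) k) ^ 2 ≤ 4 * (B + 2) ^ 2 := by
    calc ∑ k : Fin 4, (((⟨b, μ⟩ : Edge 0).src + mkPt u : E4) k) ^ 2 ≤ ∑ _k : Fin 4, (B + 2) ^ 2 :=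
          Finset.sum_le_sum fun k _ => by
            rw [← sq_abs]; exact pow_le_pow_left₀ (abs_nonneg _) (hcoord k) 2
      _ = 4 * (B + 2) ^ 2 := by simp
  calc Real.sqrt (∑ k : Fin 4, ‖(((⟨b, μ⟩ : Edge 0).src + mkPt u : E4) k)‖ ^ 2)
      ≤ Real.sqrt (4 * (B + 2) ^ 2) := Real.sqrt_le_sqrt (by simpa only [Real.norm_eq_abs, sq_abs] using h4)
    _ = 2 * (B + 2) := by
        rw [show (4 : ℝ) * (B + 2) ^ 2 = (2 * (B + 2)) ^ 2 by ring, Real.sqrt_sq (by positivity)]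

/-- **Bond variables are controlled in `L¹`**: `|A(b, μ)| ≤ ∫_{B_ρ} |A_μ|` whenever the bond box lies in the ball `B_ρ`
(tent weight `≤ 1`, the box parametrisation is measure preserving). [cite: Federbush1986PhaseCellI, (2.1)–(2.2) p. 325, (2.5) p. 325] -/
theorem abs_approxTop_le_setIntegral {A : E4 → Fin 4 → ℝ} (hA : Continuous A) (b : Fin 4 → ℤ) (μ : Fin 4) {ρ : ℝ}
    (hρ : ∀ u ∈ Icc (0 : Fin 4 → ℝ) (boxUp μ), ‖(((⟨b, μ⟩ : Edge 0).src) + mkPt u : E4)‖ ≤ ρ) :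
    |approxTop 0 A ⟨b, μ⟩| ≤ ∫ x in closedBall (0 : E4) ρ, |A x μ| := by
  set f : (Fin 4 → ℝ) → ℝ := fun u => tent (u μ) * A (((⟨b, μ⟩ : Edge 0).src) + mkPt u) μ with hf
  have hmk : Continuous (fun u : Fin 4 → ℝ => (mkPt u : E4)) := PiLp.continuous_toLp 2 _
  have hAμ : Continuous fun y : E4 => A y μ := (continuous_apply μ).comp hA
  have hg : Continuous fun u : Fin 4 → ℝ => A (((⟨b, μ⟩ : Edge 0).src) + mkPt u) μ :=
    hAμ.comp (continuous_const.add hmk)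
  have hK : IsCompact (Icc (0 : Fin 4 → ℝ) (boxUp μ)) := isCompact_Icc
  have happrox : approxTop 0 A ⟨b, μ⟩ = ∫ u in Icc (0 : Fin 4 → ℝ) (boxUp μ), f u := by
    show latLen 0 * _ = _
    rw [latLen_zero, one_mul]
    refine setIntegral_congr_fun measurableSet_Icc fun u _ => ?_
    simp [hf]
  rw [happrox]
  -- `|∫ f| ≤ ∫ |A(x_b + u)|`
  have h1 : |∫ u in Icc (0 : Fin 4 → ℝ) (boxUp μ), f u|
      ≤ ∫ u in Icc (0 : Fin 4 → ℝ) (boxUp μ), |A (((⟨b, μ⟩ : Edge 0).src) + mkPt u) μ| := by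
    refine (abs_integral_le_integral_abs).trans (setIntegral_mono_on
      (((continuous_tent.comp (continuous_apply μ)).mul hg).continuousOn.integrableOn_compact hK).abs
      (hg.abs.continuousOn.integrableOn_compact hK) measurableSet_Icc fun u hu => ?_)
    have h0 : 0 ≤ u μ := hu.1 μ
    have h2 : u μ ≤ 2 := by have := hu.2 μ; simpa [boxUp] using this
    rw [hf, abs_mul, abs_of_nonneg (tent_nonneg h0 h2)]
    have ht1 : tent (u μ) ≤ 1 := by rw [tent_eq_min]; exact min_le_iff.2 (by rcases le_or_gt (u μ) 1 with h | h <;> [left; right] <;> linarith)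
    exact mul_le_of_le_one_left (abs_nonneg _) ht1
  refine h1.trans ?_
  -- change of variables `x = x_b + u` and enlarge the domain to the ball
  have h2' := (measurePreserving_boxMap b).setIntegral_image_emb (boxMap b).measurableEmbedding (fun x => |A x μ|)
    (Icc (0 : Fin 4 → ℝ) (boxUp μ))
  have h2 : ∫ u in Icc (0 : Fin 4 → ℝ) (boxUp μ), |A (((⟨b, μ⟩ : Edge 0).src) + mkPt u) μ|
      = ∫ x in boxMap b '' Icc (0 : Fin 4 → ℝ) (boxUp μ), |A x μ| :=
    (setIntegral_congr_fun measurableSet_Icc fun u _ => rfl).trans h2'.symm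
  rw [h2]
  refine setIntegral_mono_set (hAμ.abs.continuousOn.integrableOn_compact (isCompact_closedBall _ _))
    (Eventually.of_forall fun x => abs_nonneg _) (Eventually.of_forall ?_)
  rintro x ⟨u, hu, rfl⟩
  show boxMap b u ∈ closedBall (0 : E4) ρ
  exact mem_closedBall_zero_iff.2 (hρ u hu)

/-! ## §2 The gauge-fixed competitor `ψ̂_L = ψ̃ − dλ_L`: continuous, with vanishing bond variables on the box of size `L` -/

/-- The bond variables `k(e) = ψ̃(e)` of the radial representative. [cite: Federbush1986PhaseCellI, (2.1)–(2.2) p. 325] -/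
def bondVar (ψ : E4 → Fin 4 → ℝ) : Edge 0 → ℝ := approxTop 0 (radial ψ)

/-- **The bond variables of `ψ̃` are curl-free** when `ψ` has vanishing level-0 plaquette variables.
[cite: Federbush1986PhaseCellI, (1.12)–(1.14) p. 324, §4 p. 329] -/
theorem plaqOfBonds_bondVar (hψ : ContDiff ℝ 1 ψ) (hplaq : ∀ q : Plaq 0, plaqFunctional 0 ψ q = 0) (q : Plaq 0) :
    plaqOfBonds (bondVar ψ) q = 0 := by
  rw [bondVar, plaqOfBonds_approxTop _ (continuous_radial hψ), plaqFunctional_radial hψ, hplaq]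

/-- The corner `(−L, −L, −L, −L)` of the lattice box. [cite: Federbush1986PhaseCellI, §1 p. 321] -/
def corner (L : ℕ) : Fin 4 → ℤ := fun _ => -(L : ℤ)

/-- The lattice box `[−L, L]⁴ ∩ ℤ⁴`. [cite: Federbush1986PhaseCellI, §1 p. 321] -/
def boxSet (L : ℕ) : Finset (Fin 4 → ℤ) := Fintype.piFinset fun _ => Finset.Icc (-(L : ℤ)) L

/-- Membership in the lattice box. [cite: Federbush1986PhaseCellI, §1 p. 321] -/
theorem mem_boxSet {L : ℕ} {n : Fin 4 → ℤ} : n ∈ boxSet L ↔ ∀ j, -(L : ℤ) ≤ n j ∧ n j ≤ L := by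
  simp [boxSet, Fintype.mem_piFinset]

/-- The lattice potential `g_L` of the bond variables (axial gauge from the corner). [cite: Federbush1986PhaseCellI, §1 p. 321, (4.3)–(4.5) p. 329] -/
def latPotential (ψ : E4 → Fin 4 → ℝ) (L : ℕ) : (Fin 4 → ℤ) → ℝ := axialPot (bondVar ψ) (corner L)

/-- The smooth gauge function `λ_L` interpolating `g_L` on the box. [cite: Federbush1986PhaseCellI, (3.2) p. 327, (4.5) p. 329] -/
def gaugeFn (ψ : E4 → Fin 4 → ℝ) (L : ℕ) : E4 → ℝ := interp (boxSet L) (latPotential ψ L)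

/-- `λ_L` is smooth. [cite: Federbush1986PhaseCellI, (3.2) p. 327] -/
theorem contDiff_gaugeFn (ψ : E4 → Fin 4 → ℝ) (L : ℕ) {k : ℕ∞} : ContDiff ℝ k (gaugeFn ψ L) := contDiff_interp _ _

/-- **The gauge-fixed competitor** `ψ̂_L = ψ̃ − dλ_L = ψ − d(K₀ψ + λ_L)` — a gauge transform (3.2) of `ψ`.
[cite: Federbush1986PhaseCellI, (3.2) p. 327] -/
def psiHat (ψ : E4 → Fin 4 → ℝ) (L : ℕ) : E4 → Fin 4 → ℝ := fun x ν => radial ψ x ν - pureGauge (gaugeFn ψ L) x ν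

/-- `ψ̂_L` is continuous. [cite: Federbush1986PhaseCellI, §2 p. 325] -/
theorem continuous_psiHat (hψ : ContDiff ℝ 1 ψ) (L : ℕ) : Continuous (psiHat ψ L) := by
  have h1 : Continuous (pureGauge (gaugeFn ψ L)) := continuous_pureGauge (contDiff_gaugeFn ψ L)
  exact continuous_pi fun ν => ((continuous_apply ν).comp (continuous_radial hψ)).sub ((continuous_apply ν).comp h1)

/-- `ψ̂_L` as `ψ̃ + (−1)·dλ_L` (for the additive bond-variable lemmas). [folklore] -/
private theorem psiHat_eq (ψ : E4 → Fin 4 → ℝ) (L : ℕ) :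
    psiHat ψ L = fun x ν => radial ψ x ν + ((-1 : ℝ) • pureGauge (gaugeFn ψ L)) x ν := by
  funext x ν; simp [psiHat, sub_eq_add_neg]

/-- **Bond variables of `ψ̂_L`**: `ψ̂_L(b, μ) = k(b, μ) − (g_L|_{box}(b + e_μ) − g_L|_{box}(b))`.
[cite: Federbush1986PhaseCellI, (2.1)–(2.2) p. 325, (4.3) p. 329] -/
theorem approxTop_psiHat (hψ : ContDiff ℝ 1 ψ) (L : ℕ) (b : Fin 4 → ℤ) (μ : Fin 4) :
    approxTop 0 (psiHat ψ L) ⟨b, μ⟩ = bondVar ψ ⟨b, μ⟩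
      - (restrict0 (boxSet L) (latPotential ψ L) (b + Pi.single μ 1) - restrict0 (boxSet L) (latPotential ψ L) b) := by
  have h1 : Continuous (pureGauge (gaugeFn ψ L)) := continuous_pureGauge (contDiff_gaugeFn ψ L)
  rw [psiHat_eq, approxTop_add (continuous_radial hψ) (h1.const_smul _), ModeLinearity.approxTop_smul, gaugeFn,
    approxTop_pureGauge_interp, bondVar]
  ring

/-- **THE BOND VARIABLES OF `ψ̂_L` VANISH ON THE BOX**: for `−L ≤ b_j ≤ L` and `b_μ + 1 ≤ L`, `ψ̂_L(b, μ) = 0` (the lattice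
Poincaré lemma: `g_L(b + e_μ) − g_L(b) = k(b, μ)` for curl-free `k`). [cite: Federbush1986PhaseCellI, (4.3)–(4.5) p. 329
(«Mirabile dictu the bond assignments … are exactly the A(e)»), §1 p. 321] -/
theorem approxTop_psiHat_eq_zero (hψ : ContDiff ℝ 1 ψ) (hplaq : ∀ q : Plaq 0, plaqFunctional 0 ψ q = 0) {L : ℕ}
    {b : Fin 4 → ℤ} {μ : Fin 4} (hb1 : ∀ j, -(L : ℤ) ≤ b j) (hb2 : ∀ j, b j ≤ L) (hb3 : b μ + 1 ≤ L) :
    approxTop 0 (psiHat ψ L) ⟨b, μ⟩ = 0 := by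
  have hbS : b ∈ boxSet L := mem_boxSet.2 fun j => ⟨hb1 j, hb2 j⟩
  have hbS' : b + Pi.single μ 1 ∈ boxSet L := by
    refine mem_boxSet.2 fun j => ?_
    by_cases hj : j = μ
    · subst hj; simp; constructor <;> linarith [hb1 j]
    · simp [Pi.single_eq_of_ne hj]; exact ⟨hb1 j, hb2 j⟩
  rw [approxTop_psiHat hψ, restrict0, restrict0, if_pos hbS', if_pos hbS, latPotential,
    axialPot_gradient (c := corner L) (plaqOfBonds_bondVar hψ hplaq) (fun j => hb1 j) μ, bondVar, sub_self]

/-! ## §3 Polynomial growth of `ψ̂_L` in `L¹` on balls -/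

/-- Every squared field-strength component is at most the action density. [cite: Federbush1986PhaseCellI, §0 p. 319–320] -/
theorem fieldStrength_sq_le_actionDensity (A : E4 → Fin 4 → ℝ) (μ ν : Fin 4) (x : E4) :
    fieldStrength A μ ν x ^ 2 ≤ actionDensity A x := by
  have hterm : ∀ μ' ν' : Fin 4, 0 ≤ (if μ' < ν' then fieldStrength A μ' ν' x ^ 2 else 0) := fun μ' ν' => by
    split_ifs <;> positivity
  have hle : ∀ {μ ν : Fin 4}, μ < ν → fieldStrength A μ ν x ^ 2 ≤ actionDensity A x := by
    intro μ ν hlt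
    unfold actionDensity
    calc fieldStrength A μ ν x ^ 2 = (if μ < ν then fieldStrength A μ ν x ^ 2 else 0) := by rw [if_pos hlt]
      _ ≤ ∑ ν', (if μ < ν' then fieldStrength A μ ν' x ^ 2 else 0) :=
          Finset.single_le_sum (fun ν' _ => hterm μ ν') (Finset.mem_univ ν)
      _ ≤ ∑ μ', ∑ ν', (if μ' < ν' then fieldStrength A μ' ν' x ^ 2 else 0) :=
          Finset.single_le_sum (fun μ' _ => Finset.sum_nonneg fun ν' _ => hterm μ' ν') (Finset.mem_univ μ)
  rcases lt_trichotomy μ ν with h | h | h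
  · exact hle h
  · subst h; rw [fieldStrength_self]; simpa using actionDensity_nonneg A x
  · rw [fieldStrength_swap A ν μ x, neg_sq]; exact hle h

/-- `|F|₁² ≤ 256·(action density)` (crude Cauchy–Schwarz). [cite: Federbush1986PhaseCellI, §0 p. 319–320] -/
theorem norm1_sq_le (A : E4 → Fin 4 → ℝ) (x : E4) : norm1 (fieldStrength A) x ^ 2 ≤ 256 * actionDensity A x := by
  unfold norm1
  have h1 : (∑ μ, ∑ ν, |fieldStrength A μ ν x|) ^ 2 ≤ 4 * ∑ μ, (∑ ν, |fieldStrength A μ ν x|) ^ 2 := by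
    simpa using sq_sum_le_card_mul_sum_sq (s := Finset.univ) (f := fun μ => ∑ ν, |fieldStrength A μ ν x|)
  have h2 : ∀ μ, (∑ ν, |fieldStrength A μ ν x|) ^ 2 ≤ 4 * ∑ ν, |fieldStrength A μ ν x| ^ 2 := fun μ => by
    simpa using sq_sum_le_card_mul_sum_sq (s := Finset.univ) (f := fun ν => |fieldStrength A μ ν x|)
  have h3 : ∀ μ ν, |fieldStrength A μ ν x| ^ 2 ≤ actionDensity A x := fun μ ν => by
    rw [sq_abs]; exact fieldStrength_sq_le_actionDensity A μ ν x
  calc (∑ μ, ∑ ν, |fieldStrength A μ ν x|) ^ 2 ≤ 4 * ∑ μ, (∑ ν, |fieldStrength A μ ν x|) ^ 2 := h1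
    _ ≤ 4 * ∑ μ, (4 * ∑ ν, |fieldStrength A μ ν x| ^ 2) := by gcongr with μ; exact h2 μ
    _ ≤ 4 * ∑ _μ : Fin 4, (4 * ∑ _ν : Fin 4, actionDensity A x) := by gcongr with μ _ ν; exact h3 μ ν
    _ = 256 * actionDensity A x := by simp; ring

/-- `∫|F(ψ)|₁² < ∞` for a finite-action `C¹` potential. [cite: Federbush1986PhaseCellI, §0 p. 319–320] -/
theorem integrable_norm1_sq (hψ : ContDiff ℝ 1 ψ) (hfin : contAction ψ ≠ ⊤) :
    Integrable fun y => norm1 (fieldStrength ψ) y ^ 2 := by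
  refine ((integrable_actionDensity_of_ne_top hψ hfin).const_mul 256).mono'
    (((continuous_norm1 (continuous_fieldStrength hψ)).pow 2).aestronglyMeasurable) (Eventually.of_forall fun y => ?_)
  rw [Real.norm_of_nonneg (sq_nonneg _)]
  exact norm1_sq_le ψ y

/-- A bound for `|F(ψ)|₁` on the unit ball. [cite: Federbush1986PhaseCellI, §0 p. 319–320] -/
theorem exists_sup_norm1 (hψ : ContDiff ℝ 1 ψ) :
    ∃ M, 0 ≤ M ∧ ∀ y ∈ closedBall (0 : E4) 1, norm1 (fieldStrength ψ) y ≤ M := by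
  obtain ⟨C, hC⟩ := (isCompact_closedBall (0 : E4) 1).exists_bound_of_continuousOn
    ((continuous_norm1 (continuous_fieldStrength hψ)).continuousOn)
  refine ⟨max C 0, le_max_right _ _, fun y hy => ?_⟩
  have := hC y hy
  rw [Real.norm_of_nonneg (norm1_nonneg _ _)] at this
  exact this.trans (le_max_left _ _)

/-- The polynomial `p(r) = (M+1)V4 r⁵ + S r⁴` bounding `‖ψ̃‖_{L¹(B_r)}`. [cite: Federbush1986PhaseCellI, (3.13) p. 328] -/
def growthPoly (M S r : ℝ) : ℝ := (M + 1) * V4 * r ^ 5 + S * r ^ 4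

/-- `p ≥ 0` on `r ≥ 0`. [cite: Federbush1986PhaseCellI, (3.13) p. 328] -/
theorem growthPoly_nonneg {M S : ℝ} (hM : 0 ≤ M) (hS : 0 ≤ S) {r : ℝ} (hr : 0 ≤ r) : 0 ≤ growthPoly M S r := by
  unfold growthPoly; have := V4_nonneg; positivity

/-- `p` is monotone on `r ≥ 0`. [cite: Federbush1986PhaseCellI, (3.13) p. 328] -/
theorem growthPoly_mono {M S : ℝ} (hM : 0 ≤ M) (hS : 0 ≤ S) {r r' : ℝ} (hr : 0 ≤ r) (h : r ≤ r') :
    growthPoly M S r ≤ growthPoly M S r' := by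
  unfold growthPoly
  have hV := V4_nonneg
  gcongr

/-- **`L¹` growth of the radial representative**: `∫_{B_r}|ψ̃_ν| ≤ p(r)` for `r ≥ 1`. [cite: Federbush1986PhaseCellI, (3.2) p. 327, (3.13) p. 328] -/
theorem setIntegral_abs_radial_le (hψ : ContDiff ℝ 1 ψ) {M S : ℝ} (hM0 : 0 ≤ M)
    (hM : ∀ y ∈ closedBall (0 : E4) 1, norm1 (fieldStrength ψ) y ≤ M)
    (hint : Integrable fun y => norm1 (fieldStrength ψ) y ^ 2) (hS : ∫ y, norm1 (fieldStrength ψ) y ^ 2 ≤ S)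
    {r : ℝ} (hr : 1 ≤ r) (ν : Fin 4) :
    ∫ x in closedBall (0 : E4) r, |radial ψ x ν| ≤ growthPoly M S r := by
  have h : (fun x => |radial ψ x ν|) = fun x => |vectorPot (fieldStrength ψ) x ν| :=
    funext fun x => by rw [radial_eq_vectorPot hψ]
  rw [h]
  exact setIntegral_abs_vectorPot_le (continuous_fieldStrength hψ) hM0 hM hint hS hr ν

/-- **Bond variables in `L¹`**: `|k(b, μ)| ≤ ∫_{B_{2(B+2)}}|ψ̃_μ|` when `|b_k| ≤ B`. [cite: Federbush1986PhaseCellI, (2.1)–(2.2), (2.5) p. 325] -/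
theorem abs_bondVar_le (hψ : ContDiff ℝ 1 ψ) {b : Fin 4 → ℤ} {μ : Fin 4} {B : ℝ} (hb : ∀ k, |(b k : ℝ)| ≤ B) :
    |bondVar ψ ⟨b, μ⟩| ≤ ∫ x in closedBall (0 : E4) (2 * (B + 2)), |radial ψ x μ| :=
  abs_approxTop_le_setIntegral (continuous_radial hψ) b μ fun _ hu => norm_src_add_mkPt_le hb hu

/-- The vertices of the axial path from the corner to a point of the box stay in the box. [cite: Federbush1986PhaseCellI, §1 p. 321] -/
theorem abs_vtx_add_single_le {L : ℕ} {n : Fin 4 → ℤ} (hn : n ∈ boxSet L) (k : Fin 4) {t : ℕ}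
    (ht : t ∈ Finset.range (n k - corner L k).toNat) (j : Fin 4) :
    |(((vtx (corner L) n k + Pi.single k (t : ℤ) : Fin 4 → ℤ) j : ℤ) : ℝ)| ≤ L := by
  have hn' := mem_boxSet.1 hn
  have hk1 := (hn' k).1
  have hk2 := (hn' k).2
  have hj1 := (hn' j).1
  have hj2 := (hn' j).2
  have ht' : t < (n k - corner L k).toNat := Finset.mem_range.1 ht
  have htlt : (t : ℤ) < n k + L := by
    have h0 : (0 : ℤ) ≤ n k + L := by linarith
    simp only [corner, sub_neg_eq_add] at ht'
    omega
  have key : |(vtx (corner L) n k + Pi.single k (t : ℤ) : Fin 4 → ℤ) j| ≤ (L : ℤ) := by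
    rw [abs_le]
    simp only [Pi.add_apply, vtx, corner]
    by_cases hj : j = k
    · subst hj
      simp only [lt_self_iff_false, if_false, Pi.single_eq_same]
      constructor <;> omega
    · rw [Pi.single_eq_of_ne hj, add_zero]
      split_ifs
      · exact ⟨hj1, hj2⟩
      · constructor <;> omega
  have := (Int.cast_le (R := ℝ)).2 key
  simpa [Int.cast_abs] using this

/-- The path sum of absolute values is at most (number of bonds) × (a common bound). [cite: Federbush1986PhaseCellI, §1 p. 321] -/
theorem axialAbs_le (a : Edge 0 → ℝ) (c m : Fin 4 → ℤ) {P : ℝ}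
    (h : ∀ (k : Fin 4) (t : ℕ), t ∈ Finset.range (m k - c k).toNat → |a ⟨vtx c m k + Pi.single k (t : ℤ), k⟩| ≤ P) :
    axialAbs a c m ≤ (∑ k : Fin 4, ((m k - c k).toNat : ℝ)) * P := by
  unfold axialAbs
  rw [Finset.sum_mul]
  refine Finset.sum_le_sum fun k _ => ?_
  calc ∑ t ∈ Finset.range (m k - c k).toNat, |a ⟨vtx c m k + Pi.single k (t : ℤ), k⟩|
      ≤ ∑ _t ∈ Finset.range (m k - c k).toNat, P := Finset.sum_le_sum fun t ht => h k t ht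
    _ = ((m k - c k).toNat : ℝ) * P := by rw [Finset.sum_const, Finset.card_range, nsmul_eq_mul]

/-- **The lattice potential grows at most like `8L·‖ψ̃‖_{L¹(B_{2(L+2)})}` on the box.** [cite: Federbush1986PhaseCellI, §1 p. 321, (4.3)–(4.5) p. 329] -/
theorem abs_latPotential_le (hψ : ContDiff ℝ 1 ψ) {L : ℕ} {P : ℝ}
    (hP : ∀ μ, ∫ x in closedBall (0 : E4) (2 * ((L : ℝ) + 2)), |radial ψ x μ| ≤ P) {n : Fin 4 → ℤ}
    (hn : n ∈ boxSet L) : |latPotential ψ L n| ≤ 8 * L * P := by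
  have hP0 : 0 ≤ P := (setIntegral_nonneg measurableSet_closedBall fun x _ => abs_nonneg _).trans (hP 0)
  have hn' := mem_boxSet.1 hn
  unfold latPotential
  refine (abs_axialPot_le (bondVar ψ) (corner L) n).trans ?_
  -- every bond on the path has base coordinates in `[−L, L]`
  have hterm : ∀ (k : Fin 4) (t : ℕ), t ∈ Finset.range (n k - corner L k).toNat →
      |bondVar ψ ⟨vtx (corner L) n k + Pi.single k (t : ℤ), k⟩| ≤ P := fun k t ht => by
    refine (abs_bondVar_le hψ (B := (L : ℝ)) fun j => ?_).trans (hP k)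
    exact abs_vtx_add_single_le hn k ht j
  have hcount : ∀ k : Fin 4, ((n k - corner L k).toNat : ℝ) ≤ 2 * L := by
    intro k
    have h2 := (hn' k).2
    have h1 := (hn' k).1
    have h3 : (n k - corner L k).toNat ≤ 2 * L := by
      have h4 : n k - corner L k ≤ 2 * (L : ℤ) := by simp only [corner]; linarith
      have h5 : 0 ≤ n k - corner L k := by simp only [corner]; linarith
      zify [h5]
      rw [Int.toNat_of_nonneg h5]
      exact h4
    exact_mod_cast h3
  refine (axialAbs_le (bondVar ψ) (corner L) n hterm).trans ?_
  calc (∑ k : Fin 4, ((n k - corner L k).toNat : ℝ)) * P ≤ (∑ _k : Fin 4, (2 * L : ℝ)) * P :=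
        mul_le_mul_of_nonneg_right (Finset.sum_le_sum fun k _ => hcount k) hP0
    _ = 8 * L * P := by rw [Finset.sum_const, Finset.card_univ, Fintype.card_fin, nsmul_eq_mul]; push_cast; ring

/-- **Pointwise bound on the gauge correction** `|∂_νλ_L(x)| ≤ B·8L·P`. [cite: Federbush1986PhaseCellI, (3.2) p. 327] -/
theorem abs_pureGauge_gaugeFn_le (hψ : ContDiff ℝ 1 ψ) {L : ℕ} {P : ℝ}
    (hP : ∀ μ, ∫ x in closedBall (0 : E4) (2 * ((L : ℝ) + 2)), |radial ψ x μ| ≤ P)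
    {B : ℝ} (hB : (∀ y, |cellBump y| ≤ B) ∧ ∀ y, ‖fderiv ℝ cellBump y‖ ≤ B) (x : E4) (ν : Fin 4) :
    |pureGauge (gaugeFn ψ L) x ν| ≤ B * (8 * L * P) := by
  have hP0 : 0 ≤ P := (setIntegral_nonneg measurableSet_closedBall fun x _ => abs_nonneg _).trans (hP 0)
  have h := (interp_bound hB (boxSet L) (latPotential ψ L) (x := x) (M := 8 * L * P) (by positivity)
    fun n hn _ => abs_latPotential_le hψ hP hn).2 (unitVec ν)
  have hu : ‖(unitVec ν : E4)‖ = 1 := by simp [unitVec]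
  rw [hu, mul_one] at h
  exact h

/-- **`L¹` bound for `ψ̂_L` on a ball**: `∫_{B_r}|ψ̂_{L,ν}| ≤ p(r) + r⁴V4·B·8L·p(2(L+2))`.
[cite: Federbush1986PhaseCellI, (3.2) p. 327, (3.13) p. 328] -/
theorem setIntegral_abs_psiHat_le (hψ : ContDiff ℝ 1 ψ) {M S : ℝ} (hM0 : 0 ≤ M)
    (hM : ∀ y ∈ closedBall (0 : E4) 1, norm1 (fieldStrength ψ) y ≤ M)
    (hint : Integrable fun y => norm1 (fieldStrength ψ) y ^ 2) (hS : ∫ y, norm1 (fieldStrength ψ) y ^ 2 ≤ S)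
    {B : ℝ} (hB : (∀ y, |cellBump y| ≤ B) ∧ ∀ y, ‖fderiv ℝ cellBump y‖ ≤ B)
    {r : ℝ} (hr : 1 ≤ r) (L : ℕ) (ν : Fin 4) :
    ∫ x in closedBall (0 : E4) r, |psiHat ψ L x ν|
      ≤ growthPoly M S r + r ^ 4 * V4 * (B * (8 * L * growthPoly M S (2 * ((L : ℝ) + 2)))) := by
  have hK : IsCompact (closedBall (0 : E4) r) := isCompact_closedBall _ _
  have hr0 : 0 ≤ r := zero_le_one.trans hr
  have hP : ∀ μ, ∫ x in closedBall (0 : E4) (2 * ((L : ℝ) + 2)), |radial ψ x μ| ≤ growthPoly M S (2 * ((L : ℝ) + 2)) :=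
    fun μ => setIntegral_abs_radial_le hψ hM0 hM hint hS (by have := L.cast_nonneg (α := ℝ); linarith) μ
  have hc1 : Continuous fun x => radial ψ x ν := (continuous_apply ν).comp (continuous_radial hψ)
  have hc2 : Continuous fun x => pureGauge (gaugeFn ψ L) x ν :=
    (continuous_apply ν).comp (continuous_pureGauge (contDiff_gaugeFn ψ L))
  have hc0 : Continuous fun x => |psiHat ψ L x ν| := ((continuous_apply ν).comp (continuous_psiHat hψ L)).abs
  calc ∫ x in closedBall (0 : E4) r, |psiHat ψ L x ν|
      ≤ ∫ x in closedBall (0 : E4) r, (|radial ψ x ν| + |pureGauge (gaugeFn ψ L) x ν|) :=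
        setIntegral_mono_on (hc0.continuousOn.integrableOn_compact hK)
          ((hc1.abs.add hc2.abs).continuousOn.integrableOn_compact hK) measurableSet_closedBall fun x _ => abs_sub _ _
    _ = (∫ x in closedBall (0 : E4) r, |radial ψ x ν|) + ∫ x in closedBall (0 : E4) r, |pureGauge (gaugeFn ψ L) x ν| :=
        integral_add (hc1.abs.continuousOn.integrableOn_compact hK) (hc2.abs.continuousOn.integrableOn_compact hK)
    _ ≤ growthPoly M S r + ∫ _x in closedBall (0 : E4) r, B * (8 * L * growthPoly M S (2 * ((L : ℝ) + 2))) := by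
        refine add_le_add (setIntegral_abs_radial_le hψ hM0 hM hint hS hr ν) ?_
        exact setIntegral_mono_on (hc2.abs.continuousOn.integrableOn_compact hK)
          (continuous_const.continuousOn.integrableOn_compact hK) measurableSet_closedBall
          fun x _ => abs_pureGauge_gaugeFn_le hψ hP hB x ν
    _ = growthPoly M S r + r ^ 4 * V4 * (B * (8 * L * growthPoly M S (2 * ((L : ℝ) + 2)))) := by
        rw [setIntegral_const, measureReal_def, volume_closedBall_toReal hr0, smul_eq_mul]

/-- **THE GROWTH BOUND**: there is `C ≥ 0` with `∫_{B_{4R+10}} |ψ̂_{2R+6, ν}| ≤ C (R + 10)^{10}` for every `R ∈ ℕ` — polynomial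
growth of the gauge-fixed competitor on the balls carrying the cut-off. [cite: Federbush1986PhaseCellI, (3.2) p. 327, (3.13) p. 328] -/
theorem exists_psiHat_growth (hψ : ContDiff ℝ 1 ψ) (hfin : contAction ψ ≠ ⊤) :
    ∃ C, 0 ≤ C ∧ ∀ (R : ℕ) (ν : Fin 4),
      ∫ x in closedBall (0 : E4) (4 * R + 10), |psiHat ψ (2 * R + 6) x ν| ≤ C * ((R : ℝ) + 10) ^ 10 := by
  obtain ⟨M, hM0, hM⟩ := exists_sup_norm1 hψ
  have hint := integrable_norm1_sq hψ hfin
  set S := ∫ y, norm1 (fieldStrength ψ) y ^ 2 with hSdef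
  have hS0 : 0 ≤ S := integral_nonneg fun y => sq_nonneg _
  obtain ⟨B, hB0, hB⟩ := exists_cellBump_bound
  have hV := V4_nonneg
  set c₁ : ℝ := (M + 1) * V4 * 4 ^ 5 + S * 4 ^ 4 with hc₁
  have hc₁0 : 0 ≤ c₁ := by positivity
  refine ⟨c₁ + 4096 * V4 * B * c₁, by positivity, fun R ν => ?_⟩
  set X : ℝ := (R : ℝ) + 10 with hX
  have hX1 : 1 ≤ X := by have := R.cast_nonneg (α := ℝ); linarith
  have hX0 : 0 ≤ X := zero_le_one.trans hX1
  -- `p(y) ≤ c₁ X⁵` for `0 ≤ y ≤ 4X`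
  have hp : ∀ y : ℝ, 0 ≤ y → y ≤ 4 * X → growthPoly M S y ≤ c₁ * X ^ 5 := by
    intro y hy0 hy
    unfold growthPoly
    have h5 : y ^ 5 ≤ (4 * X) ^ 5 := pow_le_pow_left₀ hy0 hy 5
    have h4 : y ^ 4 ≤ (4 * X) ^ 4 := pow_le_pow_left₀ hy0 hy 4
    have h45 : X ^ 4 ≤ X ^ 5 := pow_le_pow_right₀ hX1 (by norm_num)
    rw [hc₁]
    nlinarith [mul_nonneg (mul_nonneg (by positivity : (0:ℝ) ≤ M + 1) hV) (sub_nonneg.2 h5),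
      mul_nonneg hS0 (sub_nonneg.2 h4), mul_nonneg hS0 (sub_nonneg.2 h45)]
  have hr : (1 : ℝ) ≤ 4 * R + 10 := by have := R.cast_nonneg (α := ℝ); linarith
  have hmain := setIntegral_abs_psiHat_le hψ hM0 hM hint le_rfl hB hr (2 * R + 6) ν
  have hr4X : (4 * (R : ℝ) + 10) ≤ 4 * X := by rw [hX]; linarith
  have hL2X : ((2 * R + 6 : ℕ) : ℝ) ≤ 2 * X := by push_cast; rw [hX]; linarith
  have hρ4X : 2 * (((2 * R + 6 : ℕ) : ℝ) + 2) ≤ 4 * X := by push_cast; rw [hX]; linarith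
  have e1 : growthPoly M S (4 * R + 10) ≤ c₁ * X ^ 5 := hp _ (by positivity) hr4X
  have e2 : growthPoly M S (2 * (((2 * R + 6 : ℕ) : ℝ) + 2)) ≤ c₁ * X ^ 5 := hp _ (by positivity) hρ4X
  have e3 : (4 * (R : ℝ) + 10) ^ 4 ≤ (4 * X) ^ 4 := pow_le_pow_left₀ (by positivity) hr4X 4
  have e4 : X ^ 5 ≤ X ^ 10 := pow_le_pow_right₀ hX1 (by norm_num)
  calc ∫ x in closedBall (0 : E4) (4 * R + 10), |psiHat ψ (2 * R + 6) x ν|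
      ≤ growthPoly M S (4 * R + 10) + (4 * (R : ℝ) + 10) ^ 4 * V4 *
          (B * (8 * ((2 * R + 6 : ℕ) : ℝ) * growthPoly M S (2 * (((2 * R + 6 : ℕ) : ℝ) + 2)))) := by
        exact_mod_cast hmain
    _ ≤ c₁ * X ^ 5 + (4 * X) ^ 4 * V4 * (B * (8 * (2 * X) * (c₁ * X ^ 5))) := by
        have hgp2 : 0 ≤ growthPoly M S (2 * (((2 * R + 6 : ℕ) : ℝ) + 2)) := growthPoly_nonneg hM0 hS0 (by positivity)
        refine add_le_add e1 (mul_le_mul (mul_le_mul_of_nonneg_right e3 hV) ?_ (by positivity) (by positivity))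
        refine mul_le_mul_of_nonneg_left ?_ hB0
        exact mul_le_mul (by linarith) e2 hgp2 (by positivity)
    _ = c₁ * X ^ 5 + 4096 * V4 * B * c₁ * X ^ 10 := by ring
    _ ≤ (c₁ + 4096 * V4 * B * c₁) * X ^ 10 := by nlinarith [mul_nonneg hc₁0 (sub_nonneg.2 e4)]

end RadialGauge

end

end Literature.MathematicalPhysics.QuantumFieldTheory.Federbush1986
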